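import Literature.MathematicalPhysics.QuantumFieldTheory.Balaban1983to89.Node00.RateRecord11
import Literature.MathematicalPhysics.QuantumFieldTheory.Balaban1983to89.B12Decay510
import Literature.MathematicalPhysics.QuantumFieldTheory.Balaban1983to89.B13Lemma3TorusNonvacuity

/-!
# BalabanUVNodes ∕ node N22 = NE9 — module J92: THE LOCATED SIZE OF «ONE LETTER ℓ.κ, TWO PRINTED RATES» (director-ym №276) IN KERNEL FORM, AT THE N22 END

Cell `pub-ymgap`, HUMAN RULING D-0062 (Track A), R134 seat `pub-ymgap-dag-n22-c` (strategy s1), generation 24, module J92.  THEOREMS ONLY (no `def`, no `sorry`,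
standard axioms); `--kind proof --supports stmt-QuantumFields-27366 --as helper` (K3⁸), COUNT-NEUTRAL.  Imports NODE 00's `RateRecord11` (`U3Letters₁₁`), `B12Decay510`
(`delta1` = (5.10)'s example rate `½ min{δ₀, κM⁻¹}`) and `B13Lemma3TorusNonvacuity` (the certified constants record `consts`).  Nothing re-declared.

WHAT IS SIZED.  Director-ym №276 (2026-08-29) booked dag-n27-c's ⚑ LOCATED-SIZE as a burden of record on the K3⁸ docket: the single U3 letter `(ℓ F θ).κ` — the decay
slot `R.u3.κ` of node U3's bundle of record, `(u3OfRecord₁₃ θ (objectsOfRecord₁₃ F N θ ℓ) k).κ = ℓ.κ` by `rfl` — is consumed at BOTH ends: node N19′'s `hlink` thresholds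
it with the ACTIVITY animal-census constant, `kappa₀ (4 * 2 ^ d₀) (2 * d₀) ≤ R.u3.κ` (`…N19RateEdgeTube`, d₀ = 4), while this lane's ROAD-2 socket of record J89
(`…N22AtRecordOfTermDataTableGermsLocatedRadiiMembersOfLemma2Records`, p702380) caps it by the KERNEL rate of (5.10), `hℓκ : ℓ.κ ≤ delta1 δ₀ κ ((M : ℝ) * 4)`, next to
`hκ₅ : delta1 δ₀ κ ((M : ℝ) * 4) ≤ κ₅` (κ₅ = node N18's kernel-step rate), `hκE : κ ≤ κE`, `hκr : κE ≤ r₁` (κ = J89's own ACTIVITY letter, `hκ₀ : kappa₀ (4 * 2 ^ 4) (2 * 4) ≤ κ / 2`;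
r₁ = the decay rate of the admissible histories `AdmHist (sp K) E₀ r₁`), `hrate : r₁ + 2·(64·log 162) + 2 ≤ (1 − 8c.δ)·(c.L/2)·c.κ` and the fading-memory row `hC₉` with
its factor `Real.exp (delta1 δ₀ κ ((M:ℝ)*4) * ((M:ℝ)*4) * 3)`.  At the N22 pin the slot IS a rate per UNIT ℓ¹-length of the limiting kernel's lattice argument
(`n22At_u3OfRecord₁₃_objectsOfRecord₁₃_iff_kernels`: weight `Real.exp (−(ℓ.κ * l1 z))`), i.e. (5.10)'s δ₁ currency; inside J89 print's conversion κ ↦ ½ min{δ₀, κ(4M)⁻¹} is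
carried by `delta1`'s third argument, so the two printed constants are two binders there (κ and ℓ.κ).  Node N27's K3⁸ leaf over J89 (p703694) displays both families on the one
letter (`hκ₀ : kappa₀ (4 * 2 ^ 4) (2 * 4) ≤ (ℓ F θ).κ` and `hℓκ`).  THIS FILE records what the floor forces on the OTHER letters — the propagation list of the burden — as
elementary real arithmetic on the rows' VERBATIM types:
* §0 numerals: `325 < kappa₀ 64 8 < 327` (κ₀ = 64·log 162 — dag-n10's `…N10AtRecord12B13Family.kappa₀_64_8`, `TreeLengthCubeSystem.kappa₀_four`; unfolded locally, not
  restated), `kappa₀ (4 * 2 ^ 4) (2 * 4) = kappa₀ 64 8`; the unfolded right side of `hrate` at `consts` and `consts.κ = 20(κ₀ + 64)`.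
* §1 ★ `locatedSize_of_kernelSlotFloor`: floor + `hℓκ hκ₅ hκE hκr` ⊢ `2κ₀ ≤ δ₀`, `8Mκ₀ ≤ κ ≤ κE ≤ r₁`, `κ₀ ≤ κ₅` (a THIRD end: node N18's step rate), and the `hC₉` factor is
  `≥ exp (12Mκ₀)`; numeric faces `650 < δ₀`, `2600·M < κ`, `2600·M < r₁`, `325 < κ₅`, `exp (3900·M) < …` (`locatedSize_numerals`).
* §2 at the ONLY certified constants record `consts` (`δ = 3/40`, `L = 8`, `κ = 20(κ₀ + 64)`): `hrate` at `c := consts` with a floor-sized `r₁ ≥ 8Mκ₀` forces the block count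
  `M ≤ 4` (`blockCount_le_four_of_floor_consts`; `M = 4` meets that row, `blockCount_four_meets_hrate_consts`); and on module J90's certificate range
  `r₁ ∈ [2κ₀ + 1, consts.κ − 1]` a floor-sized `r₁` exists iff `M ≤ 2` (`floorSized_in_certificateRange_iff`).  Print takes M «sufficiently large» ([I] p.257).

HONEST FRAMING (binding).  A located SIZE on displayed hypothesis letters, in kernel form; the joint letters stay SATISFIABLE (no vacuity, no flag — №276 (2)); nothing of
Bałaban's is asserted or denied; no statement of record is edited (DO-NOT-REKEY №265–№269); N22 NOT discharged; K3⁸ OPEN; counts UNMOVED; one finite 𝕋⁴ programme at fixed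
ε — NOTHING about the continuum, ℝ⁴, infinite volume, OS, a mass gap or Clay.
References (TYPES only): [I] = Bałaban, CMP 109 (1987) (0.25) p. 257 (d_j(X) «divided by M»), (1.18) p. 263, (1.20)–(1.22) p. 264, (5.10) p. 293 («δ₁ = ½ min{δ₀, κM⁻¹}»);
[II] = CMP 116 (1988) (2.13)–(2.14) pp. 14–15, (2.40)–(2.41) p. 21; Dimock, arXiv:1108.1335 App. A Lemma 25 (κ₀ = c₀·log(2(Δ+1)²)).
-/

namespace YMDAG.N22.KernelFading

open Literature.MathematicalPhysics.QuantumFieldTheory.Balaban1983to89.Node00 (U3Letters₁₁)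
open Literature.MathematicalPhysics.QuantumFieldTheory.Balaban1983to89.B12TreeDecay (kappa₀ a₀ kappa₀_nonneg)
open Literature.MathematicalPhysics.QuantumFieldTheory.Balaban1983to89.B12Decay510 (delta1 delta1_le_half delta1_mul_le)
open Literature.MathematicalPhysics.QuantumFieldTheory.Balaban1983to89.B13Lemma3TorusNonvacuity (consts consts_L)

/-! ## §0 Numerals -/

/-- The spelling `kappa₀ (4·2⁴) (2·4)` of the rows IS `kappa₀ 64 8`. [folklore] -/
theorem kappa₀_four_eq : kappa₀ (4 * 2 ^ 4) (2 * 4) = kappa₀ 64 8 := by norm_num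

/-- `325/64 < log 162` (`e⁵ < 2.7182818286⁵`, `e^{5/64} ≤ 1 + 5/64 + (5/64)²`, product `< 162`). [folklore] -/
theorem log_162_gt : (325 : ℝ) / 64 < Real.log 162 := by
  rw [Real.lt_log_iff_exp_lt (by norm_num)]
  have h1 : Real.exp 1 < 2.7182818286 := Real.exp_one_lt_d9
  have h5 : Real.exp 5 < (2.7182818286 : ℝ) ^ 5 := by
    have e5 : Real.exp 5 = Real.exp 1 ^ 5 := by rw [← Real.exp_nat_mul]; norm_num
    rw [e5]; exact pow_lt_pow_left₀ h1 (Real.exp_pos 1).le (by norm_num)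
  have hx : Real.exp (5 / 64 : ℝ) ≤ 1 + 5 / 64 + (5 / 64) ^ 2 := by
    have h := Real.abs_exp_sub_one_sub_id_le (x := (5 / 64 : ℝ)) (by rw [abs_of_nonneg (by norm_num)]; norm_num)
    have := (abs_le.1 h).2; linarith
  have e : Real.exp ((325 : ℝ) / 64) = Real.exp 5 * Real.exp (5 / 64) := by rw [← Real.exp_add]; norm_num
  rw [e]
  calc Real.exp 5 * Real.exp (5 / 64) < (2.7182818286 : ℝ) ^ 5 * (1 + 5 / 64 + (5 / 64) ^ 2) :=
        mul_lt_mul h5 hx (Real.exp_pos _) (by positivity)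
    _ < 162 := by norm_num

/-- `log 162 < 327/64` (`2.7182818283⁵ < e⁵`, `1 + 7/64 ≤ e^{7/64}`, product `> 162`). [folklore] -/
theorem log_162_lt : Real.log 162 < (327 : ℝ) / 64 := by
  rw [Real.log_lt_iff_lt_exp (by norm_num)]
  have h1 : (2.7182818283 : ℝ) < Real.exp 1 := Real.exp_one_gt_d9
  have h5 : (2.7182818283 : ℝ) ^ 5 < Real.exp 5 := by
    have e5 : Real.exp 5 = Real.exp 1 ^ 5 := by rw [← Real.exp_nat_mul]; norm_num
    rw [e5]; exact pow_lt_pow_left₀ h1 (by norm_num) (by norm_num)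
  have hx : (1 : ℝ) + 7 / 64 ≤ Real.exp (7 / 64) := by have := Real.add_one_le_exp (7 / 64 : ℝ); linarith
  have e : Real.exp ((327 : ℝ) / 64) = Real.exp 5 * Real.exp (7 / 64) := by rw [← Real.exp_add]; norm_num
  rw [e]
  calc (162 : ℝ) < (2.7182818283 : ℝ) ^ 5 * (1 + 7 / 64) := by norm_num
    _ ≤ Real.exp 5 * Real.exp (7 / 64) := mul_le_mul h5.le hx (by norm_num) (Real.exp_pos _).le

/-- **`325 < κ₀(64, 8)`** (= 325.61…). [folklore] -/
theorem kappa₀_64_8_gt : (325 : ℝ) < kappa₀ 64 8 := by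
  have e : kappa₀ 64 8 = 64 * Real.log 162 := by unfold kappa₀ a₀; norm_num
  rw [e]; have := log_162_gt; linarith

/-- **`κ₀(64, 8) < 327`**. [folklore] -/
theorem kappa₀_64_8_lt : kappa₀ 64 8 < 327 := by
  have e : kappa₀ 64 8 = 64 * Real.log 162 := by unfold kappa₀ a₀; norm_num
  rw [e]; have := log_162_lt; linarith

/-- THE RIGHT SIDE OF `hrate` AT THE CERTIFIED RECORD: `(1 − 8·consts.δ)·(consts.L/2)·consts.κ = 32·κ₀ + 2048` (`δ = 3/40`, `L = 8`, `κ = 20(κ₀ + 64)`).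
[cite: Balaban1988RG2Cluster, p.21 (closing paragraph; bookkeeping at the witness)] -/
theorem hrate_rhs_consts : (1 - 8 * consts.δ) * ((consts.L : ℝ) / 2) * consts.κ = 32 * kappa₀ 64 8 + 2048 := by
  rw [consts_L]
  show (1 - 8 * (3 / 40 : ℝ)) * (((8 : ℕ) : ℝ) / 2) * (20 * (kappa₀ 64 8 + 64)) = 32 * kappa₀ 64 8 + 2048
  push_cast; ring

/-- THE CERTIFIED RECORD's DECAY LETTER: `consts.κ = 20·(κ₀ + 64)` (= 7792.2…). [cite: Balaban1988RG2Cluster, p.21 (closing paragraph; bookkeeping at the witness)] -/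
theorem consts_κ_eq : consts.κ = 20 * (kappa₀ 64 8 + 64) := rfl

/-! ## §1 ★ What the census floor on the kernel slot forces on J89's other letters -/

/-- ★ **THE PROPAGATION LIST OF THE LOCATED SIZE (№276), N22 END.**  On the row types VERBATIM as displayed by J89 — `hκE : κ ≤ κE`, `hκr : κE ≤ r₁`,
`hκ₅ : delta1 δ₀ κ ((M : ℝ) * 4) ≤ κ₅`, `hℓκ : ℓ.κ ≤ delta1 δ₀ κ ((M : ℝ) * 4)` — the census floor `kappa₀ (4 * 2 ^ 4) (2 * 4) ≤ ℓ.κ` of `hlink` (d₀ = 4) on the pinned slot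
`R.u3.κ = ℓ.κ` forces: `2κ₀ ≤ δ₀` (δ₁ ≤ δ₀/2), `8Mκ₀ ≤ κ ≤ κE ≤ r₁` (δ₁·4M ≤ κ/2: the activity letter and the admissible-history decay rate), `κ₀ ≤ κ₅` (node N18's
kernel-step rate — a third end), and the fading-memory factor of `hC₉` is at least `exp (12Mκ₀)`.  Letters only; nothing asserted about any object.
[cite: Balaban1987RG1, (5.10) p.293 (δ₁ = ½ min{δ₀, κM⁻¹}) and (0.25) p.257 (κ; bookkeeping on hypothesis letters)] -/
theorem locatedSize_of_kernelSlotFloor (ℓ : U3Letters₁₁) (M : ℕ) [NeZero M] {κ κE r₁ δ₀ κ₅ : ℝ}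
    (hκE : κ ≤ κE) (hκr : κE ≤ r₁) (hκ₅ : delta1 δ₀ κ ((M : ℝ) * 4) ≤ κ₅) (hℓκ : ℓ.κ ≤ delta1 δ₀ κ ((M : ℝ) * 4))
    (hfloor : kappa₀ (4 * 2 ^ 4) (2 * 4) ≤ ℓ.κ) :
    2 * kappa₀ 64 8 ≤ δ₀ ∧ 8 * (M : ℝ) * kappa₀ 64 8 ≤ κ ∧ 8 * (M : ℝ) * kappa₀ 64 8 ≤ κE ∧ 8 * (M : ℝ) * kappa₀ 64 8 ≤ r₁ ∧ kappa₀ 64 8 ≤ κ₅ ∧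
      Real.exp (12 * (M : ℝ) * kappa₀ 64 8) ≤ Real.exp (delta1 δ₀ κ ((M : ℝ) * 4) * ((M : ℝ) * 4) * 3) := by
  rw [kappa₀_four_eq] at hfloor
  have hM : (0 : ℝ) < (M : ℝ) := by exact_mod_cast Nat.pos_of_ne_zero (NeZero.ne M)
  have hM4 : (0 : ℝ) < (M : ℝ) * 4 := by positivity
  have h1 : kappa₀ 64 8 ≤ delta1 δ₀ κ ((M : ℝ) * 4) := hfloor.trans hℓκ
  have hδ₀ : 2 * kappa₀ 64 8 ≤ δ₀ := by have := delta1_le_half δ₀ κ ((M : ℝ) * 4); linarith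
  have hκ : 8 * (M : ℝ) * kappa₀ 64 8 ≤ κ := by
    have h2 : delta1 δ₀ κ ((M : ℝ) * 4) * ((M : ℝ) * 4) ≤ κ / 2 := delta1_mul_le δ₀ κ hM4
    have h3 : kappa₀ 64 8 * ((M : ℝ) * 4) ≤ delta1 δ₀ κ ((M : ℝ) * 4) * ((M : ℝ) * 4) := mul_le_mul_of_nonneg_right h1 hM4.le
    linarith
  refine ⟨hδ₀, hκ, hκ.trans hκE, hκ.trans (hκE.trans hκr), h1.trans hκ₅, Real.exp_le_exp.2 ?_⟩
  have e : 12 * (M : ℝ) * kappa₀ 64 8 = kappa₀ 64 8 * ((M : ℝ) * 4) * 3 := by ring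
  rw [e]
  exact mul_le_mul_of_nonneg_right (mul_le_mul_of_nonneg_right h1 hM4.le) (by norm_num)

/-- ★ **NUMERIC FACES OF THE PROPAGATION LIST** (`κ₀ > 325`, `M ≥ 1`): the floor forces `650 < δ₀`, `2600·M < κ`, `2600·M < r₁`, `325 < κ₅` and an `hC₉` factor
`> exp (3900·M)` — against print's O(1) minimiser rate δ₀ and δ₁ = ½ min{δ₀, κM⁻¹}.  Letters only.
[cite: Balaban1987RG1, (5.10) p.293 and p.282 (δ₀, δ₁; bookkeeping on hypothesis letters)] -/
theorem locatedSize_numerals (ℓ : U3Letters₁₁) (M : ℕ) [NeZero M] {κ κE r₁ δ₀ κ₅ : ℝ}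
    (hκE : κ ≤ κE) (hκr : κE ≤ r₁) (hκ₅ : delta1 δ₀ κ ((M : ℝ) * 4) ≤ κ₅) (hℓκ : ℓ.κ ≤ delta1 δ₀ κ ((M : ℝ) * 4))
    (hfloor : kappa₀ (4 * 2 ^ 4) (2 * 4) ≤ ℓ.κ) :
    650 < δ₀ ∧ 2600 * (M : ℝ) < κ ∧ 2600 * (M : ℝ) < r₁ ∧ 325 < κ₅ ∧
      Real.exp (3900 * (M : ℝ)) < Real.exp (delta1 δ₀ κ ((M : ℝ) * 4) * ((M : ℝ) * 4) * 3) := by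
  obtain ⟨hδ₀, hκ, -, hr₁, h₅, hC₉⟩ := locatedSize_of_kernelSlotFloor ℓ M hκE hκr hκ₅ hℓκ hfloor
  have hκ₀ := kappa₀_64_8_gt
  have hM : (1 : ℝ) ≤ (M : ℝ) := by exact_mod_cast Nat.pos_of_ne_zero (NeZero.ne M)
  have hMκ : 2600 * (M : ℝ) < 8 * (M : ℝ) * kappa₀ 64 8 := by nlinarith
  refine ⟨by linarith, hMκ.trans_le hκ, hMκ.trans_le hr₁, hκ₀.trans_le h₅, lt_of_lt_of_le (Real.exp_lt_exp.2 (by nlinarith)) hC₉⟩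

/-! ## §2 At the certified constants record `consts`: the floor caps the block count -/

/-- ★ **AT `consts` THE FLOOR CAPS THE BLOCK COUNT: `M ≤ 4`.**  J89's `hrate` at `c := consts` reads `r₁ + 2κ₀ + 2 ≤ 32κ₀ + 2048`; with a floor-sized history rate
`8Mκ₀ ≤ r₁` (§1) and `κ₀ > 325` this leaves `M ≤ 4` — whereas print takes the block count M «sufficiently large».  A located size at ONE certified record; other
constants records (larger `c.κ`, matching smaller `c.ε₁`) are not excluded, none is certified. [cite: Balaban1987RG1, p.257 (M-cubes, «M sufficiently large»; bookkeeping)] -/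
theorem blockCount_le_four_of_floor_consts (M : ℕ) {r₁ : ℝ}
    (hrate : r₁ + 2 * (64 * Real.log 162) + 2 ≤ (1 - 8 * consts.δ) * ((consts.L : ℝ) / 2) * consts.κ)
    (hr : 8 * (M : ℝ) * kappa₀ 64 8 ≤ r₁) : M ≤ 4 := by
  have e : kappa₀ 64 8 = 64 * Real.log 162 := by unfold kappa₀ a₀; norm_num
  rw [hrate_rhs_consts, ← e] at hrate
  have hκ₀ := kappa₀_64_8_gt
  by_contra h
  have h5 : (5 : ℝ) ≤ (M : ℝ) := by exact_mod_cast Nat.lt_of_not_le h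
  have hprod : 5 * kappa₀ 64 8 ≤ (M : ℝ) * kappa₀ 64 8 := mul_le_mul_of_nonneg_right h5 (le_of_lt (lt_trans (by norm_num) hκ₀))
  nlinarith

/-- `M = 4` MEETS `hrate` AT `consts` with the floor-sized `r₁ := 32κ₀` (`34κ₀ + 2 ≤ 32κ₀ + 2048` as `κ₀ < 327`) — so `4` is the exact cap of THAT row (the other rows of
J89 are not re-certified here). [cite: Balaban1987RG1, p.257 (bookkeeping)] -/
theorem blockCount_four_meets_hrate_consts :
    ∃ r₁ : ℝ, 8 * ((4 : ℕ) : ℝ) * kappa₀ 64 8 ≤ r₁ ∧ r₁ + 2 * (64 * Real.log 162) + 2 ≤ (1 - 8 * consts.δ) * ((consts.L : ℝ) / 2) * consts.κ := by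
  refine ⟨32 * kappa₀ 64 8, by push_cast; linarith, ?_⟩
  have e : kappa₀ 64 8 = 64 * Real.log 162 := by unfold kappa₀ a₀; norm_num
  rw [hrate_rhs_consts, ← e]
  have := kappa₀_64_8_lt
  linarith

/-- ★ **ON MODULE J90's CERTIFICATE RANGE `r₁ ∈ [2κ₀ + 1, consts.κ − 1]` A FLOOR-SIZED `r₁` EXISTS IFF `M ≤ 2`** (`consts.κ − 1 = 20κ₀ + 1279`; `24κ₀ > 20κ₀ + 1279` as
`κ₀ > 325`, `16κ₀ ≤ 20κ₀ + 1279`).  So J90's joint witness of J89's non-owner binders (which sits at `ℓ.κ ≤ ½`, below the floor, and never claimed the floor) cannot be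
moved onto the floor on its stated range unless `M ≤ 2`. [cite: Balaban1988RG2Cluster, p.21 (closing paragraph; bookkeeping at the witness)] -/
theorem floorSized_in_certificateRange_iff (M : ℕ) :
    (∃ r₁ : ℝ, 2 * kappa₀ (4 * 2 ^ 4) (2 * 4) + 1 ≤ r₁ ∧ r₁ ≤ consts.κ - 1 ∧ 8 * (M : ℝ) * kappa₀ 64 8 ≤ r₁) ↔ M ≤ 2 := by
  rw [kappa₀_four_eq, consts_κ_eq]
  have hκ₀ := kappa₀_64_8_gt
  constructor
  · rintro ⟨r₁, -, h2, h3⟩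
    by_contra h
    have h3' : (3 : ℝ) ≤ (M : ℝ) := by exact_mod_cast Nat.lt_of_not_le h
    have hprod : 3 * kappa₀ 64 8 ≤ (M : ℝ) * kappa₀ 64 8 := mul_le_mul_of_nonneg_right h3' (le_of_lt (lt_trans (by norm_num) hκ₀))
    nlinarith
  · intro hM
    have hM' : (M : ℝ) ≤ 2 := by exact_mod_cast hM
    have hprod : (M : ℝ) * kappa₀ 64 8 ≤ 2 * kappa₀ 64 8 := mul_le_mul_of_nonneg_right hM' (le_of_lt (lt_trans (by norm_num) hκ₀))
    exact ⟨20 * (kappa₀ 64 8 + 64) - 1, by linarith, le_rfl, by nlinarith⟩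

end YMDAG.N22.KernelFading
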